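import Summits.CriticalPhenomena.PercolationContinuityZ3.Theorems.Transplant.KNCells2SchemeO
import Summits.CriticalPhenomena.PercolationContinuityZ3.Theorems.Transplant.KNCells2Scheme
import Summits.CriticalPhenomena.PercolationContinuityZ3.Theorems.Transplant.KNCellsStepsSubboxO
import Summits.CriticalPhenomena.PercolationContinuityZ3.Theorems.Transplant.KNCellsStepsSubbox
import Summits.CriticalPhenomena.PercolationContinuityZ3.Theorems.Transplant.KNLevelsTargetChain
import Summits.CriticalPhenomena.PercolationContinuityZ3.Theorems.Transplant.KNCellsSchemeO
import Summits.CriticalPhenomena.PercolationContinuityZ3.Theorems.Transplant.KNCellsProcessO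
import Summits.CriticalPhenomena.PercolationContinuityZ3.Theorems.Transplant.KNCellsStepsDefsO
import Summits.CriticalPhenomena.PercolationContinuityZ3.Theorems.Transplant.KNCellsStepsReachO
import Summits.CriticalPhenomena.PercolationContinuityZ3.Theorems.Transplant.KNCellsStepsPinO
import Summits.CriticalPhenomena.PercolationContinuityZ3.Theorems.Transplant.KNCells2Corridor
import Literature.Probability.Percolation.OrientedHistorySiteRenormalizationRun
import HarnessLib

/-!
# N2 (frames-only node `SamePDropOfSkeletonFrm₁`, OPEN) — ORIENTED MACRO LAYER (WAVE 0 (c1), (R-18) `q ≡ true`): the oriented twin of N1's `KNCells2Corridor`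

builds on p205010 (kernel theorem, internal audit signed; external expert review pending) — nothing in this file uses p205010; NOTHING is claimed about the
open node `SamePDropOfSkeletonFrm₁` (`SamePDropOfSkeletonNeg₁` is CLOSED in the tree and untouched by this file).
Status sentence (coordinator 2026-08-20T04:30Z): "θ(p_c) = 0 on ℤ^d, all d ≥ 2 — kernel-verified (Lean 4/Mathlib, standard axioms); internal adversarial
audit SIGNED 2026-08-20 04:29Z; external expert review pending."
Lane `prim-bschramm-*`, seat `prim-bschramm-stmt` (gen 19); helper file (`--supports stmt-CriticalPhenomena-4575 --as helper`); N2-SCOPE §20, (R-18)/(R-19).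
PORT RULES (HOME/prim-bschramm-stmt-g19/lean/port_orient.py): the history-site API is replaced by its ORIENTED twin at the fixed quadrant `qNE := fun _ => true`
(`HState.choice ↦ HState.ochoice qNE`, `mstOf ↦ omstOf qNE`, `mst/stN ↦ omst/ostN qNE`, `occFinal ↦ ooccFinal qNE`, `Lawful ↦ OLawful qNE`, onward directions
`onward ↦ onwardO` = the POSITIVE ones, (N2-e)); every declaration whose text changes thereby — directly or through a changed declaration — is re-declared with the
suffix `O` (same namespace); unchanged declarations of the N1 file are NOT repeated (the N1 module is imported). Docstrings/citations are N1's.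
N1 HEADER (kept for the reader):
* `Ucor`, `Wcor = restrW U μ`; `finSupp_Wcor`, **`isSubbox_Wcor`** (every `Dd ⊆ U ∩ (E_i ∪ E_{v,x} ∪ E_{x,y})` disjoint from `E_i` is a subbox:
  only the edges of `E_i` are pinned), `Wcor_apply_of_mem`;
* **`lt_real_reachB_Wcor`** — the SOURCE of the chain: (32) (`Valid₂.reach`: `1 - δc < P_{W₀}(root ↔ M^α_x)`) gives
  `1 - δc < P_{Wcor}(root ↔ X₀(0))` for every first level `X₀(0) ⊇ M^α_x`;
* **`hreach_of_chain`** — a linked chain of `n + 1` steps with source `root`, kits at the accuracy `δ` of `TargetProperty.chain` (with `δc ≤ δ`),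
  first core `⊇ M^α_x` and last target `M^β_{x+du}`, gives `1 - ε'' < P_μ(Reach h e α β du)` — the hypothesis `hreach` of `fail_bound₂`.
[cite: KozmaNitzan2024, §4 Lemma 12 (pp. 23–25), p. 30 (Step IV, first claim) — the ℤ^d model] [cite: GrimmettPercolation1999, §7.2]
-/
noncomputable section

open MeasureTheory ProbabilityTheory
open scoped ENNReal Classical

namespace Summit.CriticalPhenomena.PercolationContinuityZ3.Theorems

namespace Transplant

namespace KNCells

open Literature.Probability.Percolation Literature.Probability.LatticeModels SimpleGraph GadgetSystem ProbeHistory HSiteScheme Contour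

variable {V : Type*} [DecidableEq V]

namespace KSchA

variable {A : Type*} (G : SimpleGraph V) [G.LocallyFinite] (S : KSchA V A) (FD : FaceData V A)

variable {G S FD}
variable {h : ProbeHistory V} {e : Site 2 × MDir} {a a' : A} {du : MDir}

variable [Countable V]

/-- **The source of the chain**: after a valid history, `1 - δc < P_{Wcor}(root ↔ B)` for every `B ⊇ M^α_x` — (32) read inside
`E_i ∪ E^α_{v,x} ⊆ U`, where `Wcor` and `W₀` agree. [cite: KozmaNitzan2024, §4 p. 28 ((32)), p. 30] -/
theorem lt_real_reachB_WcorO (hV : S.Valid₂O G h e) (hroot : S.Γ.root ∈ S.Ucor G FD h e (S.aOf₁O G h e) a' du)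
    {B : Finset V} (hB : S.Γ.M (S.aOf₁O G h e) (tgt e) ⊆ B) :
    1 - S.δc < (prodBernoulli (S.Wcor G FD h e (S.aOf₁O G h e) a' du)).real (⋃ b ∈ B, openConn S.Γ.root b) := by
  set α := S.aOf₁O G h e with hα
  set D := S.Vx G h ∪ S.Γ.Ewv α e.1 e.2 with hD
  have h0 : S.Γ.root ∈ (↑D : Set V) := Finset.mem_coe.2 (Finset.mem_union_left _ hV.root_mem)
  -- (32) inside `E_i ∪ E_{v,x}`
  have h32 : 1 - S.δc < (prodBernoulli (pinW (KNLevels.lattW G S.p) ↑(S.F G h) ↑(S.ξ G h))).real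
      (⋃ t ∈ (↑(S.Γ.M α (tgt e)) : Set V), openConnIn (↑D : Set V) S.Γ.root t) := by
    have := hV.reach
    rw [W₀, ← Finset.set_biUnion_coe, prodBernoulli_restrW_real_biUnion_openConn _ _ h0] at this
    exact this
  -- the same event under `Wcor`
  have hsubU : (↑D : Set V) ⊆ ↑(S.Ucor G FD h e α a' du) := Finset.coe_subset.2 Finset.subset_union_left
  have hsubS : (↑D : Set V) ⊆ ↑(S.Sx G h e α a' du) := Finset.coe_subset.2 Finset.subset_union_left
  have heq : ∀ x ∈ wireSet (↑D : Set V), S.Wcor G FD h e α a' du x = pinW (KNLevels.lattW G S.p) ↑(S.F G h) ↑(S.ξ G h) x := by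
    intro x hx
    unfold Wcor Wfull
    rw [restrW_apply_of_mem _ (KozmaNitzan.wireSet_mono hsubU hx), restrW_apply_of_mem _ (KozmaNitzan.wireSet_mono hsubS hx)]
  have h1 : (prodBernoulli (S.Wcor G FD h e α a' du)).real (⋃ t ∈ (↑(S.Γ.M α (tgt e)) : Set V), openConnIn (↑D : Set V) S.Γ.root t) =
      (prodBernoulli (pinW (KNLevels.lattW G S.p) ↑(S.F G h) ↑(S.ξ G h))).real
        (⋃ t ∈ (↑(S.Γ.M α (tgt e)) : Set V), openConnIn (↑D : Set V) S.Γ.root t) :=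
    prodBernoulli_real_eq_of_determinedBy _ _ heq (determinedBy_biUnion_openConnIn _ _ _ subset_rfl) (measurableSet_biUnion_openConnIn _ _ _)
  have h2 : (⋃ t ∈ (↑(S.Γ.M α (tgt e)) : Set V), openConnIn (↑D : Set V) S.Γ.root t) ⊆ ⋃ b ∈ B, openConn S.Γ.root b := by
    refine (biUnion_openConnIn_subset_biUnion_openConn _ _ _).trans ?_
    intro ω hω
    simp only [Set.mem_iUnion, exists_prop, Finset.mem_coe] at hω ⊢
    obtain ⟨t, ht, hωt⟩ := hω
    exact ⟨t, hB ht, hωt⟩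
  have _ := hroot
  calc 1 - S.δc < _ := h32
    _ = _ := h1.symm
    _ ≤ _ := measureReal_mono h2 (measure_ne_top _ _)

/-- **LEMMA 12 OVER CELLS ⟹ `hreach`.**  After a valid history, at the history anchors `(α, β)` and an onward direction `du`: a chain of
`n + 1` target steps `s₀, …, s_n` with source `root`, linked (`T_i ⊆ X_{i+1}(0)`), all with kits at accuracy `δ` under the corridor weighting
`Wcor`, first core containing `M^α_x`, last target `M^β_{x+du}`, where `δ` is the accuracy of `TargetProperty.chain` at `(ε'', n)` and `δc ≤ δ`,
yields `1 - ε'' < P_μ(Reach h e α β du)`. [cite: KozmaNitzan2024, §4 Lemma 12 (pp. 23–25), p. 30 (Step IV)] -/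
theorem hreach_of_chainO (hV : S.Valid₂O G h e) {Δ : ℕ} {δ ε'' : ℝ} {n : ℕ} (hδc : S.δc ≤ δ)
    (hchain : ∀ (W : Sym2 V → unitInterval) (s : Fin (n + 1) → KNLevels.TStep G),
      (∀ i : Fin (n + 1), (s i).L.o = (s 0).L.o) →
      (∀ i : Fin n, (s (Fin.castSucc i)).T ⊆ (s i.succ).L.X 0) →
      (∀ i : Fin (n + 1), (s i).KitsAt W S.p Δ δ) →
      1 - δ < (prodBernoulli W).real (s 0).L.reachB →
        1 - ε'' < (prodBernoulli W).real (⋃ t ∈ (s (Fin.last n)).T, openConn (s 0).L.o t))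
    (s : Fin (n + 1) → KNLevels.TStep G) (ho : ∀ i : Fin (n + 1), (s i).L.o = S.Γ.root)
    (hlink : ∀ i : Fin n, (s (Fin.castSucc i)).T ⊆ (s i.succ).L.X 0)
    (hkits : ∀ i : Fin (n + 1), (s i).KitsAt (S.Wcor G FD h e (S.aOf₁O G h e) a' du) S.p Δ δ)
    (hB0 : S.Γ.M (S.aOf₁O G h e) (tgt e) ⊆ (s 0).L.X 0) (hTn : (s (Fin.last n)).T = S.Γ.M a' (tgt e + stepVec du)) :
    1 - ε'' < (prodBernoulli (S.Wfull G h e (S.aOf₁O G h e) a' du)).real (S.Reach G FD h e (S.aOf₁O G h e) a' du) := by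
  set α := S.aOf₁O G h e with hα
  have hroot : S.Γ.root ∈ S.Ucor G FD h e α a' du := Finset.mem_union_left _ (Finset.mem_union_left _ hV.root_mem)
  have ho' : ∀ i : Fin (n + 1), (s i).L.o = (s 0).L.o := fun i => by rw [ho i, ho 0]
  have hsrc : 1 - δ < (prodBernoulli (S.Wcor G FD h e α a' du)).real (s 0).L.reachB := by
    have := lt_real_reachB_WcorO hV hroot hB0 (a' := a') (du := du)
    rw [KNLevels.LData.reachB, ho 0]
    linarith
  have hc := hchain _ s ho' hlink hkits hsrc
  rw [hTn, ho 0, Wcor, ← Finset.set_biUnion_coe, prodBernoulli_restrW_real_biUnion_openConn _ _ (Finset.mem_coe.2 hroot)] at hc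
  exact hc

end KSchA

end KNCells

end Transplant

end Summit.CriticalPhenomena.PercolationContinuityZ3.Theorems

end
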